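import Summits.KontsevichZagierPeriods.KontsevichZagierPeriods.Theorems.UnfoldedStokesDefs

/-!
# `StokesGeneration` (stmt-KontsevichZagierPeriods-3586) — line `fibrewise_stokes`, stub `fibStokesDecomposable_mul_fresh`

Closure of the S2 class `FibStokesDecomposable` (route definitions file `Theorems/UnfoldedStokesDefs.lean`) under
products with a continuous `ℚ`-semialgebraic function `g` of ONE FRESH VARIABLE: if `h` on `[0,1]^M` is
fibrewise-Stokes decomposable then so is `x ↦ h (x₀, …, x_{M-1}) · g (x_M)` on `[0,1]^{M+1}`.

Proof (pure bookkeeping). Take a package for `h` on the padded cube `[0,1]^{M'}` (`M ≤ M'`). The fresh variable is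
read, through `Fin.castLE : Fin (M+1) → Fin (M'+1)`, at the coordinate `p := M` of the new padded cube `[0,1]^{M'+1}`,
and the old padded cube is recovered by deleting that coordinate, `y ↦ (y ∘ p.succAbove)` (`Fin.succAbove p` skips
`p`; on the first `M` coordinates it is the identity). Every element is multiplied by the factor `g (y p)`, which is
CONSTANT along the new fibre directions `p.succAbove (i j) ≠ p`: primitives `G j (y ∘ p.succAbove) · g (y p)`, fibre
derivatives `D j (y ∘ p.succAbove) · g (y p)`, kink sets and the null set are coordinate preimages, and the carried
closed-cube representations have the integrands `(q j).integrand (y ∘ p.succAbove) · g (y p)` — `ℚ`-semialgebraic by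
Bochnak–Coste–Roy Prop. 2.2.6, absolutely integrable on `[0,1]^{M'+1} ≃ [0,1] × [0,1]^{M'}`
(`MeasurableEquiv.piFinSuccAbove`, measure preserving) as the product of two integrable functions of disjoint
variables (Tonelli, `MeasureTheory.Integrable.mul_prod`). The new null set `{y | y ∘ p.succAbove ∈ Z}` is the
preimage of `univ ×ˢ Z`, of measure `∞ · 0 = 0`.

References: J. Ayoub, *Une version relative de la conjecture des périodes de Kontsevich–Zagier*, Ann. of Math. 181
(2015), Rem. 1.5; J. Bochnak, M. Coste, M.-F. Roy, *Real Algebraic Geometry* (1998), §2.2 (Prop. 2.2.6);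
M. Kontsevich, D. Zagier, *Periods* (2001), §1.2, §4.1 (Fubini).
-/

noncomputable section

-- `Summit.KontsevichZagierPeriods.KontsevichZagierPeriods.…` is the tree's mandated layout (single-conjunct summit).
set_option linter.dupNamespace false

namespace Summit.KontsevichZagierPeriods.KontsevichZagierPeriods.Cruxes.StokesGeneration.FibrewiseStokes

open MeasureTheory Set
open Literature.NumberTheory.Transcendental
open Literature.NumberTheory.Transcendental.KZ
open Literature.ModelTheory.ExponentialFields (IsSemialgebraic)

/-! ### Coordinate bookkeeping along `Fin.succAbove` -/

/-- Semialgebraicity is preserved by reading a function through ANY coordinate map `e : Fin N → Fin k`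
(relabelling, deleting or duplicating coordinates): the new graph is a coordinate preimage of the old one.
[folklore] -/
theorem isSemialgebraicFunOn_comp_coord {N k : ℕ} {s : Set (Fin N → ℝ)} {f : (Fin N → ℝ) → ℝ}
    (hf : IsSemialgebraicFunOn ℚ s f) (e : Fin N → Fin k) :
    IsSemialgebraicFunOn ℚ {w : Fin k → ℝ | (fun i => w (e i)) ∈ s} (fun w => f (fun i => w (e i))) := by
  rw [isSemialgebraicFunOn_iff]
  let ρ : Fin (N + 1) → Fin (k + 1) := Fin.lastCases (Fin.last k) fun i => Fin.castSucc (e i)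
  have hΓ := (isSemialgebraicFunOn_iff.mp hf).preimage_comp ρ
  convert hΓ using 1
  have hinit : ∀ w : Fin (k + 1) → ℝ, Fin.init (w ∘ ρ) = fun i => Fin.init w (e i) := by
    intro w; ext i; simp [Fin.init, ρ]
  have hlast : ∀ w : Fin (k + 1) → ℝ, (w ∘ ρ) (Fin.last N) = w (Fin.last k) := by
    intro w; simp [ρ]
  ext w
  simp only [mem_setOf_eq, mem_preimage, hinit, hlast]

/-- Deleting the coordinate `p` maps the cube `[0,1]^{n+1}` into the cube `[0,1]^n`. [folklore] -/
theorem comp_succAbove_mem_cubePi {n : ℕ} (p : Fin (n + 1)) {y : Fin (n + 1) → ℝ}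
    (hy : y ∈ Set.pi Set.univ (fun _ : Fin (n + 1) => Set.Icc (0:ℝ) 1)) :
    (fun k => y (p.succAbove k)) ∈ Set.pi Set.univ (fun _ : Fin n => Set.Icc (0:ℝ) 1) :=
  fun k _ => hy (p.succAbove k) (Set.mem_univ _)

/-- Membership in the cube `[0,1]^{n+1}`, split into the coordinate `p` and the remaining ones. [folklore] -/
theorem mem_cubePi_succ_iff {n : ℕ} (p : Fin (n + 1)) (y : Fin (n + 1) → ℝ) :
    y ∈ Set.pi Set.univ (fun _ : Fin (n + 1) => Set.Icc (0:ℝ) 1) ↔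
      y p ∈ Set.Icc (0:ℝ) 1 ∧ (fun k => y (p.succAbove k)) ∈ Set.pi Set.univ (fun _ : Fin n => Set.Icc (0:ℝ) 1) := by
  simp only [Set.mem_univ_pi]
  exact Fin.forall_iff_succAbove p

/-- Updating the coordinate `p.succAbove a` and then deleting the coordinate `p` is updating the coordinate `a`
of the shortened vector. [folklore] -/
theorem comp_succAbove_update {n : ℕ} (p : Fin (n + 1)) (y : Fin (n + 1) → ℝ) (a : Fin n) (s : ℝ) :
    (fun k => Function.update y (p.succAbove a) s (p.succAbove k)) =
      Function.update (fun k => y (p.succAbove k)) a s := by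
  ext k
  by_cases hk : k = a
  · subst hk; simp
  · rw [Function.update_of_ne hk, Function.update_of_ne (fun h => hk (Fin.succAbove_right_injective h))]

/-- Updating a coordinate `p.succAbove a ≠ p` does not change the coordinate `p`. [folklore] -/
theorem update_succAbove_apply_self {n : ℕ} (p : Fin (n + 1)) (y : Fin (n + 1) → ℝ) (a : Fin n) (s : ℝ) :
    Function.update y (p.succAbove a) s p = y p :=
  Function.update_of_ne (Fin.ne_succAbove p a) s y

/-- A `ℚ`-semialgebraic function on `[0,1]^n`, read on `[0,1]^{n+1}` through deletion of the coordinate `p`, times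
a `ℚ`-semialgebraic function of the coordinate `p`, is `ℚ`-semialgebraic on `[0,1]^{n+1}` (coordinate preimages
and Bochnak–Coste–Roy Prop. 2.2.6). [folklore] -/
theorem isSemialgebraicFunOn_comp_succAbove_mul {n : ℕ} (p : Fin (n + 1)) {F : (Fin n → ℝ) → ℝ} {g : ℝ → ℝ}
    (hF : IsSemialgebraicFunOn ℚ (Set.pi Set.univ (fun _ : Fin n => Set.Icc (0:ℝ) 1)) F)
    (hg : IsSemialgebraicFunOn ℚ (Set.pi Set.univ (fun _ : Fin 1 => Set.Icc (0:ℝ) 1)) (fun z => g (z 0))) :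
    IsSemialgebraicFunOn ℚ (Set.pi Set.univ (fun _ : Fin (n + 1) => Set.Icc (0:ℝ) 1))
      (fun y => F (fun k => y (p.succAbove k)) * g (y p)) := by
  have hS : IsSemialgebraic ℚ (Set.pi Set.univ (fun _ : Fin (n + 1) => Set.Icc (0:ℝ) 1)) := by
    rw [← cube_eq_pi]; exact isSemialgebraic_cube
  have h1 : IsSemialgebraicFunOn ℚ (Set.pi Set.univ (fun _ : Fin (n + 1) => Set.Icc (0:ℝ) 1))
      (fun y => F (fun k => y (p.succAbove k))) :=
    (isSemialgebraicFunOn_comp_coord hF p.succAbove).mono (fun y hy => comp_succAbove_mem_cubePi p hy) hS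
  have h2 : IsSemialgebraicFunOn ℚ (Set.pi Set.univ (fun _ : Fin (n + 1) => Set.Icc (0:ℝ) 1))
      (fun y => g (y p)) := by
    refine (isSemialgebraicFunOn_comp_coord hg (fun _ : Fin 1 => p)).mono (fun y hy => ?_) hS
    simp only [Set.mem_setOf_eq, Set.mem_univ_pi]
    exact fun _ => hy p (Set.mem_univ _)
  exact h1.fun_mul h2

/-! ### Product measure along `MeasurableEquiv.piFinSuccAbove` -/

/-- **Tonelli on `[0,1]^{n+1} ≃ [0,1] × [0,1]^n`.** The product of an integrable function of the coordinates
`≠ p` and an integrable function of the coordinate `p` is integrable on the cube (`Integrable.mul_prod` transported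
along the measure-preserving `MeasurableEquiv.piFinSuccAbove`). [folklore] -/
theorem integrableOn_comp_succAbove_mul {n : ℕ} (p : Fin (n + 1)) {f : (Fin n → ℝ) → ℝ} {g : ℝ → ℝ}
    (hf : IntegrableOn f (Set.pi Set.univ (fun _ : Fin n => Set.Icc (0:ℝ) 1)))
    (hg : IntegrableOn g (Set.Icc (0:ℝ) 1)) :
    IntegrableOn (fun y => f (fun k => y (p.succAbove k)) * g (y p))
      (Set.pi Set.univ (fun _ : Fin (n + 1) => Set.Icc (0:ℝ) 1)) := by
  have hmp : MeasurePreserving (MeasurableEquiv.piFinSuccAbove (fun _ : Fin (n + 1) => ℝ) p)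
      (volume : Measure (Fin (n + 1) → ℝ)) (volume : Measure (ℝ × (Fin n → ℝ))) :=
    volume_preserving_piFinSuccAbove (fun _ : Fin (n + 1) => ℝ) p
  have happ : ∀ y : Fin (n + 1) → ℝ,
      MeasurableEquiv.piFinSuccAbove (fun _ : Fin (n + 1) => ℝ) p y = (y p, fun k => y (p.succAbove k)) :=
    fun y => rfl
  have hprod : IntegrableOn (fun z : ℝ × (Fin n → ℝ) => g z.1 * f z.2)
      (Set.Icc (0:ℝ) 1 ×ˢ Set.pi Set.univ (fun _ : Fin n => Set.Icc (0:ℝ) 1)) := by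
    rw [IntegrableOn, Measure.volume_eq_prod, ← Measure.prod_restrict]
    exact hg.mul_prod hf
  have h := (hmp.integrableOn_comp_preimage
    (MeasurableEquiv.piFinSuccAbove (fun _ : Fin (n + 1) => ℝ) p).measurableEmbedding).mpr hprod
  have hset : (MeasurableEquiv.piFinSuccAbove (fun _ : Fin (n + 1) => ℝ) p) ⁻¹'
      (Set.Icc (0:ℝ) 1 ×ˢ Set.pi Set.univ (fun _ : Fin n => Set.Icc (0:ℝ) 1)) =
        Set.pi Set.univ (fun _ : Fin (n + 1) => Set.Icc (0:ℝ) 1) := by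
    ext y
    rw [Set.mem_preimage, happ, Set.mem_prod, mem_cubePi_succ_iff p y]
  have hfun : (fun z : ℝ × (Fin n → ℝ) => g z.1 * f z.2) ∘
      (MeasurableEquiv.piFinSuccAbove (fun _ : Fin (n + 1) => ℝ) p) =
        fun y => f (fun k => y (p.succAbove k)) * g (y p) := by
    funext y
    rw [Function.comp_apply, happ, mul_comm]
  rw [hset, hfun] at h
  exact h

/-- The cylinder over a Lebesgue-null set of the coordinates `≠ p` is Lebesgue-null in `ℝ^{n+1}` (preimage of
`univ ×ˢ Z` under the measure-preserving `MeasurableEquiv.piFinSuccAbove`; `∞ · 0 = 0`). [folklore] -/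
theorem volume_setOf_comp_succAbove_mem {n : ℕ} (p : Fin (n + 1)) {Z : Set (Fin n → ℝ)} (hZ : volume Z = 0) :
    volume {y : Fin (n + 1) → ℝ | (fun k => y (p.succAbove k)) ∈ Z} = 0 := by
  have hmp : MeasurePreserving (MeasurableEquiv.piFinSuccAbove (fun _ : Fin (n + 1) => ℝ) p)
      (volume : Measure (Fin (n + 1) → ℝ)) (volume : Measure (ℝ × (Fin n → ℝ))) :=
    volume_preserving_piFinSuccAbove (fun _ : Fin (n + 1) => ℝ) p
  have happ : ∀ y : Fin (n + 1) → ℝ,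
      MeasurableEquiv.piFinSuccAbove (fun _ : Fin (n + 1) => ℝ) p y = (y p, fun k => y (p.succAbove k)) :=
    fun y => rfl
  have hset : {y : Fin (n + 1) → ℝ | (fun k => y (p.succAbove k)) ∈ Z} =
      (MeasurableEquiv.piFinSuccAbove (fun _ : Fin (n + 1) => ℝ) p) ⁻¹' ((Set.univ : Set ℝ) ×ˢ Z) := by
    ext y
    rw [Set.mem_preimage, happ, Set.mem_prod, Set.mem_setOf_eq]
    simp only [Set.mem_univ, true_and]
  rw [hset, hmp.measure_preimage_equiv, Measure.volume_eq_prod, Measure.prod_prod, hZ, mul_zero]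

/-! ### The carried representations -/

/-- **The product representation** `[[0,1]^{n+1}, y ↦ f (y ∘ p.succAbove) · g (y p)]` of a closed-cube
representation `q = [[0,1]^n, f]` and a continuous `ℚ`-semialgebraic `g` on `[0,1]` inserted at the coordinate `p`
exists (Kontsevich–Zagier's Fubini product up to a coordinate permutation: semialgebraic integrand by
Bochnak–Coste–Roy Prop. 2.2.6, absolutely integrable by Tonelli). [folklore] -/
theorem exists_mulFreshRep {n : ℕ} (q : IntegralRep n)
    (hq : q.domain = Set.pi Set.univ (fun _ : Fin n => Set.Icc (0:ℝ) 1)) (p : Fin (n + 1)) {g : ℝ → ℝ}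
    (hg : IsSemialgebraicFunOn ℚ (Set.pi Set.univ (fun _ : Fin 1 => Set.Icc (0:ℝ) 1)) (fun z => g (z 0)))
    (hgc : ContinuousOn g (Set.Icc (0:ℝ) 1)) :
    ∃ r : IntegralRep (n + 1), r.domain = Set.pi Set.univ (fun _ : Fin (n + 1) => Set.Icc (0:ℝ) 1) ∧
      r.integrand = fun y => q.integrand (fun k => y (p.succAbove k)) * g (y p) :=
  ⟨{ domain := Set.pi Set.univ (fun _ : Fin (n + 1) => Set.Icc (0:ℝ) 1)
     integrand := fun y => q.integrand (fun k => y (p.succAbove k)) * g (y p)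
     isSemialgebraic_domain := by rw [← cube_eq_pi]; exact isSemialgebraic_cube
     isSemialgebraicFunOn_integrand :=
       isSemialgebraicFunOn_comp_succAbove_mul p (hq ▸ q.isSemialgebraicFunOn_integrand) hg
     integrableOn :=
       integrableOn_comp_succAbove_mul p (hq ▸ q.integrableOn) (hgc.integrableOn_compact isCompact_Icc) },
    rfl, rfl⟩

/-! ### The registered stub -/

/-- **Registered stub `fibStokesDecomposable_mul_fresh` (closure of the S2 class under products with a function of
a fresh variable).** If `h` is fibrewise-Stokes decomposable on `[0,1]^M` and `g` is continuous and `ℚ`-semialgebraic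
on `[0,1]`, then `x ↦ h (x₀, …, x_{M-1}) · g (x_M)` is fibrewise-Stokes decomposable on `[0,1]^{M+1}`: every
fibrewise Stokes element `D − (G|₁ − G|₀)` of a package for `h`, read on the padded cube with the fresh variable
inserted at the coordinate `M`, is multiplied by the factor `g (x_M)`, constant along its fibre direction (Ayoub's
type-(a) elements are a module over functions of the other variables). [cite: Ayoub2015, Rem. 1.5] -/
theorem fibStokesDecomposable_mul_fresh :
    ∀ (M : ℕ) (h : (Fin M → ℝ) → ℝ) (g : ℝ → ℝ), FibStokesDecomposable M h →
      IsSemialgebraicFunOn ℚ (Set.pi Set.univ (fun _ : Fin 1 => Set.Icc (0:ℝ) 1)) (fun z => g (z 0)) →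
      ContinuousOn g (Set.Icc (0:ℝ) 1) →
      FibStokesDecomposable (M + 1) (fun x => h (fun l => x (Fin.castSucc l)) * g (x (Fin.last M))) := by
  intro M h g ⟨M', hMM', J, i, G, D, K, q, Z, hpack, hq, hZs, hZ0, hid⟩ hg hgc
  -- the slot of the fresh variable in the new padded cube `[0,1]^{M'+1}`: the coordinate of value `M`
  obtain ⟨p, hp⟩ : ∃ p : Fin (M' + 1), (p : ℕ) = M := ⟨⟨M, Nat.lt_succ_of_le hMM'⟩, rfl⟩
  set S : Set (Fin M' → ℝ) := Set.pi Set.univ (fun _ : Fin M' => Set.Icc (0:ℝ) 1)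
  set S' : Set (Fin (M' + 1) → ℝ) := Set.pi Set.univ (fun _ : Fin (M' + 1) => Set.Icc (0:ℝ) 1)
  have hrS : ∀ y ∈ S', (fun k => y (p.succAbove k)) ∈ S := fun y hy => comp_succAbove_mem_cubePi p hy
  have hpS : ∀ y ∈ S', y p ∈ Set.Icc (0:ℝ) 1 := fun y hy => hy p (Set.mem_univ _)
  -- a bound for the continuous factor
  obtain ⟨C, hC⟩ := isCompact_Icc.exists_bound_of_continuousOn hgc
  have hC' : ∀ t ∈ Set.Icc (0:ℝ) 1, |g t| ≤ |C| := fun t ht =>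
    (Real.norm_eq_abs (g t) ▸ hC t ht).trans (le_abs_self C)
  -- the carried product representations
  choose r hrd hri using fun j => exists_mulFreshRep (q j) (hq j).1 p hg hgc
  refine ⟨M' + 1, Nat.add_le_add_right hMM' 1, J, fun j => p.succAbove (i j),
    fun j y => G j (fun k => y (p.succAbove k)) * g (y p), fun j y => D j (fun k => y (p.succAbove k)) * g (y p),
    fun j => {y | (fun k => y (p.succAbove k)) ∈ K j}, r, {y | (fun k => y (p.succAbove k)) ∈ Z},
    fun j => ?_, fun j => ⟨hrd j, fun y hy => ?_⟩, hZs.preimage_comp p.succAbove,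
    volume_setOf_comp_succAbove_mem p hZ0, fun y hy hyZ => ?_⟩
  · -- the package of the `j`-th element
    obtain ⟨h1, h2, h3, ⟨B, hB⟩, h5, h6, h7⟩ := hpack j
    refine ⟨isSemialgebraicFunOn_comp_succAbove_mul p h1 hg, isSemialgebraicFunOn_comp_succAbove_mul p h2 hg,
      h3.preimage_comp p.succAbove, ⟨|B| * |C|, fun y hy => ?_⟩, fun y hy => ?_, fun y hy => ?_,
      fun y hy hyK hyj => ?_⟩
    · -- boundedness of the primitive
      rw [abs_mul]
      exact mul_le_mul ((hB _ (hrS y hy)).trans (le_abs_self B)) (hC' _ (hpS y hy)) (abs_nonneg _)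
        (abs_nonneg _)
    · -- the kink set meets every fibre in finitely many points
      refine (h5 _ (hrS y hy)).subset fun s hs => ?_
      simp only [Set.mem_setOf_eq] at hs ⊢
      rwa [comp_succAbove_update] at hs
    · -- continuity along the closed fibre (the factor `g (y p)` is constant along it)
      refine ((h6 _ (hrS y hy)).mul (continuousOn_const (c := g (y p)))).congr fun s _ => ?_
      show G j (fun k => Function.update y (p.succAbove (i j)) s (p.succAbove k)) *
          g (Function.update y (p.succAbove (i j)) s p) =
        G j (Function.update (fun k => y (p.succAbove k)) (i j) s) * g (y p)
      rw [comp_succAbove_update, update_succAbove_apply_self]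
    · -- the fibre derivative off the kink set
      have hK : (fun k => y (p.succAbove k)) ∉ K j := hyK
      have hd := (h7 _ (hrS y hy) hK hyj).mul_const (g (y p))
      refine hd.congr_of_eventuallyEq (Filter.Eventually.of_forall fun s => ?_)
      show G j (fun k => Function.update y (p.succAbove (i j)) s (p.succAbove k)) *
          g (Function.update y (p.succAbove (i j)) s p) =
        G j (Function.update (fun k => y (p.succAbove k)) (i j) s) * g (y p)
      rw [comp_succAbove_update, update_succAbove_apply_self]
  · -- the carried representation has the integrand `D' − (G'|₁ − G'|₀)`
    rw [hri j]
    show (q j).integrand (fun k => y (p.succAbove k)) * g (y p) =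
      D j (fun k => y (p.succAbove k)) * g (y p) -
        (G j (fun k => Function.update y (p.succAbove (i j)) 1 (p.succAbove k)) *
            g (Function.update y (p.succAbove (i j)) 1 p) -
          G j (fun k => Function.update y (p.succAbove (i j)) 0 (p.succAbove k)) *
            g (Function.update y (p.succAbove (i j)) 0 p))
    rw [(hq j).2 _ (hrS y hy), comp_succAbove_update, comp_succAbove_update, update_succAbove_apply_self,
      update_succAbove_apply_self]
    ring
  · -- the identity off the null set
    have hyZ' : (fun k => y (p.succAbove k)) ∉ Z := hyZ
    have hsum := hid _ (hrS y hy) hyZ'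
    have hproj : (fun l : Fin M => y (Fin.castLE (Nat.add_le_add_right hMM' 1) (Fin.castSucc l))) =
        fun l => (fun k => y (p.succAbove k)) (Fin.castLE hMM' l) := by
      funext l
      have hl : Fin.castSucc (Fin.castLE hMM' l) < p := by
        rw [Fin.lt_def, Fin.val_castSucc, Fin.val_castLE, hp]
        exact l.isLt
      simp only [Fin.succAbove_of_castSucc_lt p _ hl]
      rfl
    have hlast : Fin.castLE (Nat.add_le_add_right hMM' 1) (Fin.last M) = p :=
      Fin.ext (by rw [Fin.val_castLE, Fin.val_last, hp])
    show h (fun l : Fin M => y (Fin.castLE (Nat.add_le_add_right hMM' 1) (Fin.castSucc l))) *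
        g (y (Fin.castLE (Nat.add_le_add_right hMM' 1) (Fin.last M))) =
      ∑ j, (r j).integrand y
    rw [hproj, hlast, hsum, Finset.sum_mul]
    simp only [hri]

end Summit.KontsevichZagierPeriods.KontsevichZagierPeriods.Cruxes.StokesGeneration.FibrewiseStokes

end
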